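import Literature.MathematicalPhysics.QuantumFieldTheory.Balaban1983to89.T3MinimiserStabilityReduction
import Literature.MathematicalPhysics.QuantumFieldTheory.Balaban1983to89.T3PrintedRegularMinimiser
import Literature.MathematicalPhysics.QuantumFieldTheory.Balaban1983to89.T3OrbitAverage
import Literature.MathematicalPhysics.QuantumFieldTheory.Balaban1983to89.B12ContinuousTransportInvariance
import Literature.MathematicalPhysics.QuantumFieldTheory.Balaban1983to89.Node00.CanonicalTransportOfRecord
import Literature.MathematicalPhysics.QuantumFieldTheory.Balaban1983to89.T3InteriorExcision
import Summits.QuantumFields.YangMills.Theorems.FluctuationComparisonRegPrIntLSupTailReduction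
import Summits.QuantumFields.YangMills.Theorems.FluctuationComparisonRegPrIntLSupTailDepthInduction
import Summits.QuantumFields.YangMills.Theorems.FluctuationComparisonRegPrIntLWreg
import Summits.QuantumFields.YangMills.Theorems.FluctuationComparisonRegPrIntLSupTailFibreOdds
import Summits.QuantumFields.YangMills.Theorems.AlphaInputsT3ACMinimiserPinMeasurable
import HarnessLib

/-!
# LINE g22-7 «harnack_split» — FH∘ (the K-uniform fibre Harnack ratio of LINE g22-6) CUT INTO ITS TWO RENORMALISATION MACHINES: SMALL-FIELD HARNACK on the fibre
# (FHs∘: analyticity ∕ bounded corrections of the small-field effective action) × LARGE-FIELD DOMINATION on the fibre (LFD∘: the R-operation ∕ large-field suppression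
# read on ONE fibre of the one-step averaging); junction FH∘ ⟸ FHs∘ + LFD∘ PROVED (three lines of `ℝ≥0∞` arithmetic — the point is the typing, not the glue)
# (crux `UnitScaleTilt.FluctuationComparisonRegPrIntL`, stmt-QuantumFields-20520; ideator `ym-r3-idea-1` g22, LENS «control»; organ-level line, NOT registered — RULING №36)

THE CONTROL QUESTION.  LINE g22-6 reduced TUBE∘ to FH∘ × FV∘ with FH∘ `FibreHarnackCan` = «on tube_r(σU) ∩ {PlaqSmall 2θ_{J+1}(b₀)} the canonical effective density
`heightDensity F γ (J+1 ≤ K) univ` is ≥ C_H × its average over the WHOLE fibre of the one-step averaging under the conditional Haar law λ_U, C_H uniform in K».  Two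
different machines of Bałaban's programme are inside that one constant, and they are uniform in `K` for DIFFERENT reasons: (A) on SMALL fields of the fibre,
`log heightDensity = −β_{J+1}·A_eff + (bounded analytic corrections)` and `β_{J+1}·osc(A_eff)` over the small part of one fibre is bounded by the window profile — the
SMALL-FIELD effective-action analysis ([Balaban1987RG1] §1, [Balaban1985UV3] Thm 2); (B) the LARGE-field part of the fibre carries at most a fraction `1 − c` of the fibre's
mass — LARGE-FIELD DOMINATION ∕ the R-operation ([Balaban1985UV3] (38)–(41), [Balaban1988Convergent] §2), on one fibre.  WHICH QUANTITY IS CONTROLLED UNIFORMLY IN K, twice: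
(A) the ratio `heightDensity(W) ∕ ∫_{fibre ∩ small} heightDensity dλ_U` for `W` in the small tube; (B) the ratio `∫_{fibre ∩ small} heightDensity dλ_U ∕ ∫_{fibre} heightDensity dλ_U`.

THE CUT (two new rows, §2; FH∘'s prefix VERBATIM):
* FHs∘ `SmallFieldHarnackCan` (NEW): `∃ C₁ > 0 before K: for a.e. interior U, λ_U-a.e. on tube_r(σU) ∩ small:  C₁ · ∫_{small} heightDensity dλ_U ≤ heightDensity(W)`
  (`small = {PlaqSmall (2·θBal F.L γ b₀ p₀ (J+1))}`; in `ℝ≥0∞`).  Only SMALL fields of the fibre occur on either side: this is the Harnack inequality of the small-field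
  effective density proper, with no large-field input at all.
* LFD∘ `FibreLargeFieldDominationCan` (NEW; no `σ`, no `r`): `∀ J, ∃ c > 0, ∀ K ≥ J+1, for a.e. interior U:  c · ∫_{fibre} heightDensity dλ_U ≤ ∫_{fibre ∩ small} heightDensity dλ_U`
  — conditioned on an INTERIOR coarse field at level `J`, the level-`(J+1)` field of the run is `2θ_{J+1}(b₀)`-small with conditional Gibbs_K-probability ≥ c, uniformly
  in `K`: large-field suppression localised to one fibre of the one-step averaging (print gives `1 − c ≤ exp(−p₀(log β_{J+1})²)`-small; only `c > 0` is asked).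
THE JUNCTION (§3, PROVED): `fibreHarnack_of_small_large : SmallFieldHarnackCan → FibreLargeFieldDominationCan → FibreHarnackCan`, `C_H := C₁·c`:
`ofReal(C₁ c)·∫ hd dλ_U = ofReal C₁·(ofReal c·∫ hd dλ_U) ≤ ofReal C₁·∫_{small} hd dλ_U ≤ hd(W)`.

THE LINE.  FH∘ ⟸ (PROVED) FHs∘ + LFD∘; with LINE g22-6: TUBE∘ ⟸ FHs∘ + LFD∘ + FV∘; with g22-5∕g22-2: PERS₁∘, POS∘.  STUBS (2, §4): `stub_smallFieldHarnackCan`,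
`stub_fibreLargeFieldDominationCan`.  Concluder: `fibreHarnackCan_of_stubs : FibreHarnackCan` (FH∘ BY NAME; row text = LINE g22-6 `tube_harnack.lean` ll.133–161 VERBATIM,
bridge `Iff.rfl`).  `lean check`: rc 0, sorries = the 2 stubs, 0 elsewhere.

WHY THIS IS A CUT AND NOT A SHRED.  The two stubs are closed by DIFFERENT chapters of the programme and fail for different reasons (FHs∘: oscillation of the effective
action near an arbitrary admissible small point + connectedness of the fibre's small region mod residual gauge; LFD∘: the large-field bound must be CONDITIONAL on one
fibre of the one-step averaging, i.e. uniform in the interior datum `U`, which print states for the unconditioned measure and for blocks); neither restates FH∘ (FHs∘ has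
no whole-fibre integral, LFD∘ has no tube, no `σ`, no pointwise value) — BC2∕BC7 probes in the companion probe file.  LFD∘ is also the natural home of the instrument's
F-letters (conditional large-field odds at `L = 3`, FL-3 F2′ measures its cousin per coarse cell).

HONEST STATUS.  Nothing of Bałaban's is asserted: FHs∘ and LFD∘ are candidate rows (stubs), the junction is three lines of arithmetic; FH∘ ∕ FHs∘ ∕ LFD∘ ∕ FV∘ ∕ TUBE∘ ∕
PERS₁∘ ∕ POS∘ ∕ PLAQTAIL∘ ∕ LFR♯ᶜ∘ ∕ S2β ∕ 20520 are NOT proved; `YM3TorusSU2` is NOT proved; rung R3 — NOT d = 4, NOT infinite volume, NOT a mass gap, NOT Clay; no summit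
is proved by a line.

References: [Balaban1985UV3] (2) p.256, (7) p.257, Thm 2 p.263, (38)–(41) p.266; [Balaban1987RG1] (0.18)–(0.22) p.255, §1; [Balaban1988Convergent] §2 (2.18)–(2.27);
[Balaban1989LargeFieldI] §1; [Balaban1985Averaging] (10) p.19, Prop. 1 p.22.
-/

open MeasureTheory Filter Topology Set
open scoped ENNReal NNReal BigOperators
open Literature.MathematicalPhysics.QuantumFieldTheory.Balaban1983to89
open Literature.MathematicalPhysics.QuantumFieldTheory.Balaban1983to89.T3ContinuumYM3Torus
open Literature.MathematicalPhysics.QuantumFieldTheory.Balaban1983to89.T3NestedUnitLaws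
open Literature.MathematicalPhysics.QuantumFieldTheory.Balaban1983to89.T3UnitLawDensityEML
open Literature.MathematicalPhysics.QuantumFieldTheory.Balaban1983to89.T3UnitScaleTilt
open Literature.MathematicalPhysics.QuantumFieldTheory.Balaban1983to89.T3TiltDescent
open Literature.MathematicalPhysics.QuantumFieldTheory.Balaban1983to89.T3PrintedRegularMinimiser
open Literature.MathematicalPhysics.QuantumFieldTheory.Balaban1983to89.T3ConstrainedMinimiser (fibre)
open Literature.MathematicalPhysics.QuantumFieldTheory.Balaban1983to89.T3LevelShift
open Literature.MathematicalPhysics.QuantumFieldTheory.Balaban1983to89.Missing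
open Literature.MathematicalPhysics.QuantumFieldTheory.Balaban1983to89.T4Continuum
open Literature.MathematicalPhysics.QuantumFieldTheory.Balaban1983to89.T3DescentFibreTower
open scoped Literature.MathematicalPhysics.QuantumFieldTheory.Balaban1983to89.T3OrbitAverage
open Literature.MathematicalPhysics.QuantumFieldTheory.Balaban1983to89.T3InteriorExcision (θBal_mul θBal_mul_le)
open Literature.MathematicalPhysics.QuantumFieldTheory.Balaban1983to89.T4AveragingDisintegration (condLaw condLaw_fibre_ae)
open Literature.MathematicalPhysics.QuantumFieldTheory.Balaban1983to89.B12ContinuousTransportInvarianceOn (continuous_dist1_SU)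


noncomputable section

set_option autoImplicit false

namespace Summit.QuantumFields.YangMills.Cruxes.FluctuationComparisonRegPrIntL.RunPairOrgan.HarnackSplit

/-! ## §1 THE ROW CONCLUDED: FH∘ (LINE g22-6 `tube_harnack.lean` §2, text VERBATIM — bridge `Iff.rfl` in any file seeing both) -/

section Rows

/-- **FH∘ · K-UNIFORM FIBRE HARNACK CONSTANT FOR THE CANONICAL EFFECTIVE DENSITY** (`FibreHarnackCan`, NEW, MEASURE∕RENORMALISATION): in TUBE∘'s prefix (verbatim up
to the admissibility clause), for every measurable admissible section `σ` and radius `r > 0` there is `C_H > 0`, chosen BEFORE the run length, such that for every run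
`K ≥ J+1` and `(dU_{J+1}.map D_{J,J+1})`-almost every INTERIOR datum `U`: for `λ_U`-almost every field `W` of the `r`-link-tube around `σ U` with plaquettes below
`2θ_{J+1}(b₀)` (small fields only), the canonical effective density `heightDensity F γ (J+1 ≤ K) univ` (lit ✓`T3TiltDescent.heightDensity`: `Z_K ×` the density of
`(D_{J+1,K})_* Gibbs_K` w.r.t. product Haar, lit ✓`map_descendTo_restrict_eq_withDensity`) at `W` is at least the fraction `C_H` of its FIBRE AVERAGE
`∫ heightDensity dλ_U` (`λ_U = condLaw dU_{J+1} D_{J,J+1} U`, the conditional HAAR law of the one-step fibre — a probability; the average runs over the WHOLE fibre,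
large fields included: they enter only this partition-function side, domination not pointwise control).  One scalar per fibre, stated in `ℝ≥0∞` (no `toReal` junk; the
fibre average is finite for a.e. `U` by integrability of `heightDensity`, lit ✓`heightDensity_props`).  Content = (i)+(iii) of TUBE∘'s docstring in Harnack form:
`log heightDensity = −β_{J+1}A_eff + O(1)` on small fields with `β_{J+1}·osc_{fibre∩small}(A_eff) ≤ b₀²(1+log β_{J+1})^{2p₀}·Vol_{J+1}` (K-free: bounded analytic corrections
of the small-field effective action, [Balaban1987RG1] §1) and the fibre partition function dominated by its small-field part ([Balaban1985UV3] (7), (41)).  WHY IT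
MIGHT FAIL: the K-uniform lower bound near an ARBITRARY admissible small point (not the conditional minimiser) needs the full small-field analysis at height `K−J−1`
plus the connectedness of the fibre's small-field region modulo the residual gauge (Poincaré-type lemma on blocks, [Balaban1985Averaging] Prop. 1); size XL.
[cite: Balaban1985UV3, (2) p.256 and (7) p.257 and Thm 2 p.263 and (41) p.266; Balaban1987RG1, (0.18)-(0.22) p.255; Balaban1988Convergent, §2] -/
def FibreHarnackCan : Prop :=
  ∀ (L : ℕ), ∃ c₀ : ℝ, 0 < c₀ ∧ c₀ ≤ 1 ∧ ∀ (c : ℝ), 0 < c → c ≤ c₀ → ∃ pS : ℝ, ∀ (b₀ p₀ : ℝ), 0 < b₀ → pS ≤ p₀ → 0 < p₀ →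
    ∃ γ₁ : ℝ, 0 < γ₁ ∧ ∀ (F : T3Family) (γ : ℝ), F.L = L → 0 < γ → γ ≤ γ₁ →
      ∀ (J : ℕ) (r : ℝ), 0 < r →
        ∀ σ : GaugeField (F.P J) 0 (Matrix.specialUnitaryGroup (Fin 2) ℂ) → GaugeField (F.P (J + 1)) 0 (Matrix.specialUnitaryGroup (Fin 2) ℂ), Measurable σ →
          (∀ U : GaugeField (F.P J) 0 (Matrix.specialUnitaryGroup (Fin 2) ℂ), PlaqSmall (θBal F.L γ (c * b₀) p₀ J) U →
            descendTo F ℰp J (J + 1) (Nat.le_succ J) (σ U) = U ∧ PlaqSmall (θBal F.L γ b₀ p₀ (J + 1)) (σ U)) →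
          ∃ C : ℝ, 0 < C ∧ ∀ (K : ℕ) (hJK : J + 1 ≤ K),
            ∀ᵐ U ∂((fieldMeasure (F.P (J + 1)) 0 (Matrix.specialUnitaryGroup (Fin 2) ℂ)).map (descendTo F ℰp J (J + 1) (Nat.le_succ J))),
              PlaqSmall (θBal F.L γ (c * b₀) p₀ J) U →
                ∀ᵐ W ∂(condLaw (fieldMeasure (F.P (J + 1)) 0 (Matrix.specialUnitaryGroup (Fin 2) ℂ)) (descendTo F ℰp J (J + 1) (Nat.le_succ J)) U),
                  (∀ b : PBond (F.P (J + 1)) 0, dist1 ((σ U b)⁻¹ * W b) < r) → PlaqSmall (2 * θBal F.L γ b₀ p₀ (J + 1)) W →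
                    ENNReal.ofReal C *
                        ∫⁻ W', ENNReal.ofReal (heightDensity F γ hJK Set.univ W')
                          ∂(condLaw (fieldMeasure (F.P (J + 1)) 0 (Matrix.specialUnitaryGroup (Fin 2) ℂ)) (descendTo F ℰp J (J + 1) (Nat.le_succ J)) U) ≤
                      ENNReal.ofReal (heightDensity F γ hJK Set.univ W)

/-! ## §2 THE CUT: FHs∘ (small-field Harnack on the fibre) and LFD∘ (large-field domination on the fibre) -/

/-- **FHs∘ · SMALL-FIELD HARNACK ON ONE FIBRE OF THE ONE-STEP AVERAGING** (`SmallFieldHarnackCan`, NEW, RENORMALISATION — small-field chapter): in FH∘'s prefix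
(verbatim), `∃ C₁ > 0` chosen BEFORE the run length such that for every `K ≥ J+1` and `(dU_{J+1}.map D_{J,J+1})`-a.e. INTERIOR datum `U`: for `λ_U`-a.e. field `W` of
the `r`-link-tube around `σ U` with plaquettes below `2θ_{J+1}(b₀)`, `C₁ · ∫_{fibre ∩ {PlaqSmall 2θ_{J+1}(b₀)}} heightDensity dλ_U ≤ heightDensity(W)` (in `ℝ≥0∞`;
`λ_U = condLaw dU_{J+1} D_{J,J+1} U`; `heightDensity F γ (J+1 ≤ K) univ` the canonical effective density, lit ✓`T3TiltDescent.heightDensity`).  ONLY SMALL FIELDS of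
the fibre occur: the Harnack inequality of the small-field effective density — `log heightDensity = −β_{J+1}A_eff + R` on small fields with `R` bounded uniformly in
`K` (analytic corrections) and `β_{J+1}·osc_{fibre ∩ small}(A_eff) ≤ b₀²(1+log β_{J+1})^{2p₀}·Vol_{J+1}` (the window profile).  WHY IT MIGHT FAIL: the bound is asked near
an ARBITRARY admissible small point `σ U` and against the average over the WHOLE small part of the fibre (not a neighbourhood of the conditional minimiser): it needs
the small-field analysis at height `K−J−1` on the full small class `2θ_{J+1}(b₀)` (twice the admissibility profile — any fixed multiple is the same chapter, but the
constants in print are stated at the profile itself) and connectedness of the fibre's small region modulo the residual gauge; size XL.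
[cite: Balaban1985UV3, (2) p.256 and Thm 2 p.263; Balaban1987RG1, (0.18)-(0.22) p.255; Balaban1985Averaging, Prop. 1 p.22] -/
def SmallFieldHarnackCan : Prop :=
  ∀ (L : ℕ), ∃ c₀ : ℝ, 0 < c₀ ∧ c₀ ≤ 1 ∧ ∀ (c : ℝ), 0 < c → c ≤ c₀ → ∃ pS : ℝ, ∀ (b₀ p₀ : ℝ), 0 < b₀ → pS ≤ p₀ → 0 < p₀ →
    ∃ γ₁ : ℝ, 0 < γ₁ ∧ ∀ (F : T3Family) (γ : ℝ), F.L = L → 0 < γ → γ ≤ γ₁ →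
      ∀ (J : ℕ) (r : ℝ), 0 < r →
        ∀ σ : GaugeField (F.P J) 0 (Matrix.specialUnitaryGroup (Fin 2) ℂ) → GaugeField (F.P (J + 1)) 0 (Matrix.specialUnitaryGroup (Fin 2) ℂ), Measurable σ →
          (∀ U : GaugeField (F.P J) 0 (Matrix.specialUnitaryGroup (Fin 2) ℂ), PlaqSmall (θBal F.L γ (c * b₀) p₀ J) U →
            descendTo F ℰp J (J + 1) (Nat.le_succ J) (σ U) = U ∧ PlaqSmall (θBal F.L γ b₀ p₀ (J + 1)) (σ U)) →
          ∃ C : ℝ, 0 < C ∧ ∀ (K : ℕ) (hJK : J + 1 ≤ K),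
            ∀ᵐ U ∂((fieldMeasure (F.P (J + 1)) 0 (Matrix.specialUnitaryGroup (Fin 2) ℂ)).map (descendTo F ℰp J (J + 1) (Nat.le_succ J))),
              PlaqSmall (θBal F.L γ (c * b₀) p₀ J) U →
                ∀ᵐ W ∂(condLaw (fieldMeasure (F.P (J + 1)) 0 (Matrix.specialUnitaryGroup (Fin 2) ℂ)) (descendTo F ℰp J (J + 1) (Nat.le_succ J)) U),
                  (∀ b : PBond (F.P (J + 1)) 0, dist1 ((σ U b)⁻¹ * W b) < r) → PlaqSmall (2 * θBal F.L γ b₀ p₀ (J + 1)) W →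
                    ENNReal.ofReal C *
                        ∫⁻ W' in {W' | PlaqSmall (2 * θBal F.L γ b₀ p₀ (J + 1)) W'}, ENNReal.ofReal (heightDensity F γ hJK Set.univ W')
                          ∂(condLaw (fieldMeasure (F.P (J + 1)) 0 (Matrix.specialUnitaryGroup (Fin 2) ℂ)) (descendTo F ℰp J (J + 1) (Nat.le_succ J)) U) ≤
                      ENNReal.ofReal (heightDensity F γ hJK Set.univ W)

/-- **LFD∘ · LARGE-FIELD DOMINATION ON ONE FIBRE OF THE ONE-STEP AVERAGING** (`FibreLargeFieldDominationCan`, NEW, RENORMALISATION — large-field chapter; no `σ`,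
no `r`): in the organ's prefix, for every level `J` there is `c > 0` chosen BEFORE the run length such that for every `K ≥ J+1` and `(dU_{J+1}.map D_{J,J+1})`-a.e.
INTERIOR datum `U`: `c · ∫_{fibre} heightDensity dλ_U ≤ ∫_{fibre ∩ {PlaqSmall 2θ_{J+1}(b₀)}} heightDensity dλ_U` (in `ℝ≥0∞`) — conditioned on an interior coarse field at
level `J`, the level-`(J+1)` field of the run `K` is `2θ_{J+1}(b₀)`-small with conditional Gibbs_K-probability at least `c`, UNIFORMLY IN `K` (the conditional law of
`D_{J+1,K}V` given `D_{J,K}V = U` has density `heightDensity∕∫ heightDensity dλ_U` w.r.t. `λ_U`, lit ✓`map_descendTo_restrict_eq_withDensity` + ✓`condLaw_fibre_ae`).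
Large-field suppression ([Balaban1985UV3] (38)–(41): the large-field part of the density is `exp(−p₀(log β)²)`-small relative to the small-field part) LOCALISED to
one fibre of the one-step averaging; only positivity of `c` is asked.  WHY IT MIGHT FAIL: print bounds large-field contributions for the full measure and per BLOCK of
the multi-scale cluster expansion, not conditionally on a single fibre `{D_{J,J+1} = U}` uniformly in the datum `U` up to the CLOSED window's edge; the conditional
version needs the R-operation's locality (the large-field region near the fibre's blocks decouples with K-uniform constants) — genuine XL content, and the instrument's
F2′ letter (FL-3) measures its per-cell cousin at `L = 3`. [cite: Balaban1985UV3, (38)-(41) p.266; Balaban1988Convergent, §2 (2.18)-(2.27); Balaban1989LargeFieldI, §1] -/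
def FibreLargeFieldDominationCan : Prop :=
  ∀ (L : ℕ), ∃ c₀ : ℝ, 0 < c₀ ∧ c₀ ≤ 1 ∧ ∀ (c : ℝ), 0 < c → c ≤ c₀ → ∃ pS : ℝ, ∀ (b₀ p₀ : ℝ), 0 < b₀ → pS ≤ p₀ → 0 < p₀ →
    ∃ γ₁ : ℝ, 0 < γ₁ ∧ ∀ (F : T3Family) (γ : ℝ), F.L = L → 0 < γ → γ ≤ γ₁ →
      ∀ (J : ℕ), ∃ cL : ℝ, 0 < cL ∧ ∀ (K : ℕ) (hJK : J + 1 ≤ K),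
        ∀ᵐ U ∂((fieldMeasure (F.P (J + 1)) 0 (Matrix.specialUnitaryGroup (Fin 2) ℂ)).map (descendTo F ℰp J (J + 1) (Nat.le_succ J))),
          PlaqSmall (θBal F.L γ (c * b₀) p₀ J) U →
            ENNReal.ofReal cL *
                ∫⁻ W', ENNReal.ofReal (heightDensity F γ hJK Set.univ W')
                  ∂(condLaw (fieldMeasure (F.P (J + 1)) 0 (Matrix.specialUnitaryGroup (Fin 2) ℂ)) (descendTo F ℰp J (J + 1) (Nat.le_succ J)) U) ≤
              ∫⁻ W' in {W' | PlaqSmall (2 * θBal F.L γ b₀ p₀ (J + 1)) W'}, ENNReal.ofReal (heightDensity F γ hJK Set.univ W')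
                ∂(condLaw (fieldMeasure (F.P (J + 1)) 0 (Matrix.specialUnitaryGroup (Fin 2) ℂ)) (descendTo F ℰp J (J + 1) (Nat.le_succ J)) U)

end Rows

/-! ## §3 THE JUNCTION (PROVED): FH∘ ⟸ FHs∘ + LFD∘ -/

/-- ★★ **THE JUNCTION — FH∘ ⟸ FHs∘ + LFD∘** (PROVED; `C_H := C₁·c_L`): prefixes aligned by `min ∕ max`, then `ofReal(C₁ c_L)·∫ hd = ofReal C₁·(ofReal c_L·∫ hd) ≤
ofReal C₁·∫_{small} hd ≤ hd(W)` for `λ_U`-a.e. `W` in the small tube. [cite: Balaban1985UV3, (7) p.257 and (38)-(41) p.266; Balaban1987RG1, (0.18)-(0.22) p.255] -/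
theorem fibreHarnack_of_small_large (hS : SmallFieldHarnackCan) (hLF : FibreLargeFieldDominationCan) : FibreHarnackCan := by
  intro L
  obtain ⟨c₁, hc₁, hc₁1, H1⟩ := hS L
  obtain ⟨c₂, hc₂, -, H2⟩ := hLF L
  refine ⟨min c₁ c₂, lt_min hc₁ hc₂, (min_le_left _ _).trans hc₁1, fun c hc hcle => ?_⟩
  obtain ⟨pS₁, hp₁⟩ := H1 c hc (hcle.trans (min_le_left _ _))
  obtain ⟨pS₂, hp₂⟩ := H2 c hc (hcle.trans (min_le_right _ _))
  refine ⟨max pS₁ pS₂, fun b₀ p₀ hb₀ hpS hp₀ => ?_⟩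
  obtain ⟨γa, hγa, Ha⟩ := hp₁ b₀ p₀ hb₀ ((le_max_left _ _).trans hpS) hp₀
  obtain ⟨γb, hγb, Hb⟩ := hp₂ b₀ p₀ hb₀ ((le_max_right _ _).trans hpS) hp₀
  refine ⟨min γa γb, lt_min hγa hγb, fun F γ hFL hγ hγle J r hr σ hσm hadm => ?_⟩
  obtain ⟨C₁, hC₁, HC⟩ := Ha F γ hFL hγ (hγle.trans (min_le_left _ _)) J r hr σ hσm hadm
  obtain ⟨cL, hcL, HL⟩ := Hb F γ hFL hγ (hγle.trans (min_le_right _ _)) J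
  refine ⟨C₁ * cL, mul_pos hC₁ hcL, fun K hJK => ?_⟩
  filter_upwards [HC K hJK, HL K hJK] with U hHU hLU
  intro hUW
  have hL := hLU hUW
  filter_upwards [hHU hUW] with W hW
  intro hWt hWs
  calc ENNReal.ofReal (C₁ * cL) *
          ∫⁻ W', ENNReal.ofReal (heightDensity F γ hJK Set.univ W')
            ∂(condLaw (fieldMeasure (F.P (J + 1)) 0 (Matrix.specialUnitaryGroup (Fin 2) ℂ)) (descendTo F ℰp J (J + 1) (Nat.le_succ J)) U)
      = ENNReal.ofReal C₁ * (ENNReal.ofReal cL *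
          ∫⁻ W', ENNReal.ofReal (heightDensity F γ hJK Set.univ W')
            ∂(condLaw (fieldMeasure (F.P (J + 1)) 0 (Matrix.specialUnitaryGroup (Fin 2) ℂ)) (descendTo F ℰp J (J + 1) (Nat.le_succ J)) U)) := by
        rw [ENNReal.ofReal_mul hC₁.le, mul_assoc]
    _ ≤ ENNReal.ofReal C₁ *
          ∫⁻ W' in {W' | PlaqSmall (2 * θBal F.L γ b₀ p₀ (J + 1)) W'}, ENNReal.ofReal (heightDensity F γ hJK Set.univ W')
            ∂(condLaw (fieldMeasure (F.P (J + 1)) 0 (Matrix.specialUnitaryGroup (Fin 2) ℂ)) (descendTo F ℰp J (J + 1) (Nat.le_succ J)) U) := by gcongr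
    _ ≤ ENNReal.ofReal (heightDensity F γ hJK Set.univ W) := hW hWt hWs

/-! ## §4 THE STUBS (2) and the by-name FH∘ concluder -/

/-- STUB · FHs∘ (NEW row; small-field chapter). [cite: Balaban1985UV3, Thm 2 p.263; Balaban1987RG1, (0.18)-(0.22) p.255] -/
theorem stub_smallFieldHarnackCan : SmallFieldHarnackCan := by
  sorry

/-- STUB · LFD∘ (NEW row; large-field chapter on one fibre). [cite: Balaban1985UV3, (38)-(41) p.266; Balaban1988Convergent, §2 (2.18)-(2.27)] -/
theorem stub_fibreLargeFieldDominationCan : FibreLargeFieldDominationCan := by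
  sorry

/-- THE UNIQUE FH∘ CONCLUDER of this line (TUBE∘ then by LINE g22-6 ✓`sectionTubeMass_of_harnack_volume` with FV∘; PERS₁∘ by g22-5 v1.1; POS∘ by g22-2).
[cite: Balaban1985UV3, (7) p.257 and (38)-(41) p.266] -/
theorem fibreHarnackCan_of_stubs : FibreHarnackCan :=
  fibreHarnack_of_small_large stub_smallFieldHarnackCan stub_fibreLargeFieldDominationCan

end Summit.QuantumFields.YangMills.Cruxes.FluctuationComparisonRegPrIntL.RunPairOrgan.HarnackSplit

end
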